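import Literature.AlgebraicGeometry.Frobenioids.PadicFrobenioidSubfunctor
import HarnessLib

/-!
# Frobenioids II, Example 1.1 (ii): the `p`-adic Frobenioid of the perfection `Φ = ord(O^⊳)^pf` ([IUTchI] Ex. 3.3 (i) `C_v`)

Mochizuki, *The geometry of Frobenioids II*, Kyushu J. Math. **62** (2008) 401–460, §1, Example 1.1 (ii), p. 8
("`Φ ⊆ Φ₀^Λ|_D` a monoprime subfunctor in monoids … we obtain … a *`p`-adic Frobenioid*")
[cite: MochizukiFrdII2008, Ex 1.1 (ii) p.8]; the instance `Φ := ord(O^⊳)^pf` (the perfection, a `ℚ`-monoprime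
submonoid of `Φ₀ = ord(O^⊳) ⊗ ℝ_{≥0}`, `Λ = ℤ`) is [IUTchI] Ex. 3.3 (i): "the assignment
`Φ_{C_v} : Spec(L) ↦ ord(O_L^⊳)^pf` determines a monoid `Φ_{C_v}` … these monoids `Φ_{C_v^⊢}`, `Φ_{C_v}` determine
`p_v`-adic Frobenioids `C_v^⊢ ⊆ C_v` [cf. [FrdII], Example 1.1, (ii), where we take 'Λ' to be `ℤ`]".

* `Realification.perf M` — the perfection `M^pf ⊆ M ⊗ ℝ_{≥0}` of a commutative monoid inside its realification
  (abc-iut-found's `Realification`): the elements some positive power of which lies in the image of `M`;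
  functorial (`Realification.map_mem_perf`); **`Realification.isQMonoprime_perf` — `M^pf ≅ ℚ_{≥0}` for
  `ℤ`-monoprime `M` (PROVED)**;
* `PadicFrd.perfSubDatum base hloc` — `A ↦ ord(O_{K_A}^⊳)^pf` as a `SubDatum` (stable, `ℚ`-monoprime for
  `p`-adic local fields by abc-iut-L1-d10's `isZMonoprime_ordInt`, nonzero on the lift of `p`);
* `PadicFrd.Datum.perf base hloc hc he : Datum D p` — **the `p`-adic Frobenioid datum of the perfection**
  (`C_v` of [IUTchI] Ex. 3.3 (i) over a base of `p_v`-adic local fields); `Datum.prim_Φ_le_perf` — the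
  absolutely primitive `Φ^⊢ = ℤ_{≥0} · ord(p)` is contained in it ("`Φ_{C_v^⊢} ⊆ Φ_{C_v}|_{D_v^⊢}`").

No statement of the paper is strengthened.
-/

noncomputable section

namespace Literature.AlgebraicGeometry.Frobenioids

open Function
open scoped NNReal

universe u

/-! ### The perfection of a monoid inside its realification -/

namespace Realification

variable (M : Type u) [CommMonoid M]

/-- The **perfection** `M^pf ⊆ M ⊗ ℝ_{≥0}`: elements of the realification some positive power of which lies in
the image of `M` (for `M ≅ ℤ_{≥0}`: `ℚ_{≥0} ⊆ ℝ_{≥0}`). [cite: MochizukiFrdI2008, §0 p.10] -/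
def perf : Submonoid (Realification M) where
  carrier := {x | ∃ n : ℕ, 0 < n ∧ x ^ n ∈ Set.range (Realification.of M)}
  one_mem' := ⟨1, Nat.one_pos, 1, by rw [pow_one, map_one]⟩
  mul_mem' := by
    rintro x y ⟨n, hn, a, ha⟩ ⟨m, hm, b, hb⟩
    have hx : x ^ (n * m) = Realification.of M (a ^ m) := by rw [pow_mul, ← ha, map_pow]
    have hy : y ^ (n * m) = Realification.of M (b ^ n) := by rw [mul_comm, pow_mul, ← hb, map_pow]
    exact ⟨n * m, Nat.mul_pos hn hm, a ^ m * b ^ n, by rw [mul_pow, hx, hy, map_mul]⟩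

variable {M}

/-- Membership in the perfection. [cite: MochizukiFrdI2008, §0 p.10] -/
theorem mem_perf_iff (x : Realification M) :
    x ∈ perf M ↔ ∃ n : ℕ, 0 < n ∧ x ^ n ∈ Set.range (Realification.of M) := Iff.rfl

/-- `M ⊆ M^pf`. [cite: MochizukiFrdI2008, §0 p.10] -/
theorem of_mem_perf (a : M) : Realification.of M a ∈ perf M := ⟨1, Nat.one_pos, a, by rw [pow_one]⟩

/-- The perfection is functorial: `(φ ⊗ ℝ_{≥0})(M^pf) ⊆ N^pf`. [cite: MochizukiFrdI2008, §0 p.10] -/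
theorem map_mem_perf {N : Type u} [CommMonoid N] (φ : M →* N) {x : Realification M} (hx : x ∈ perf M) :
    Realification.map φ x ∈ perf N := by
  obtain ⟨n, hn, a, ha⟩ := hx
  exact ⟨n, hn, φ a, by rw [← map_pow, ← ha, Realification.map_of]⟩

/-! ### `M^pf ≅ ℚ_{≥0}` for `M ≅ ℤ_{≥0}` -/

section QMonoprime

variable (eM : M ≃* Multiplicative ℕ) (E : Realification M ≃* Multiplicative ℝ≥0)

/-- The degree of `m ∈ M ≅ ℤ_{≥0}`. [cite: MochizukiFrdI2008, §0 p.10] -/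
def zdeg (m : M) : ℕ := Multiplicative.toAdd (eM m)

/-- The generator of `M ≅ ℤ_{≥0}`. [cite: MochizukiFrdI2008, §0 p.10] -/
def zgen : M := eM.symm (Multiplicative.ofAdd 1)

/-- `m = gen ^ deg(m)`. [cite: MochizukiFrdI2008, §0 p.10] -/
theorem eq_zgen_pow (m : M) : m = zgen eM ^ zdeg eM m := by
  apply eM.injective
  rw [map_pow, zgen, MulEquiv.apply_symm_apply, ← ofAdd_nsmul, smul_eq_mul, mul_one, zdeg, ofAdd_toAdd]

/-- `deg(gen ^ k) = k`. [cite: MochizukiFrdI2008, §0 p.10] -/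
theorem zdeg_zgen_pow (k : ℕ) : zdeg eM (zgen eM ^ k) = k := by
  rw [zdeg, map_pow, zgen, MulEquiv.apply_symm_apply, ← ofAdd_nsmul, smul_eq_mul, mul_one, toAdd_ofAdd]

/-- The slope `c := E(gen ⊗ 1) ∈ ℝ_{≥0}` of a realification coordinate `E`. [cite: MochizukiFrdI2008, §0 p.10] -/
def slope : ℝ≥0 := Multiplicative.toAdd (E (Realification.of M (zgen eM)))

/-- `E(m ⊗ 1) = deg(m) · c`. [cite: MochizukiFrdI2008, §0 p.10] -/
theorem toAdd_E_of (m : M) :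
    Multiplicative.toAdd (E (Realification.of M m)) = (zdeg eM m : ℝ≥0) * slope eM E := by
  conv_lhs => rw [eq_zgen_pow eM m]
  rw [map_pow, map_pow, toAdd_pow, nsmul_eq_mul, slope]

/-- The slope is nonzero (`gen ≠ 1` and `M → M ⊗ ℝ_{≥0}` is injective for monoprime `M`).
[cite: MochizukiFrdI2008, §0 p.10] -/
theorem slope_ne_zero : slope eM E ≠ 0 := by
  intro h
  have h1 : E (Realification.of M (zgen eM)) = 1 := by
    rw [← ofAdd_toAdd (E _), show Multiplicative.toAdd (E (Realification.of M (zgen eM))) = 0 from h]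
    rfl
  have h1' : E (Realification.of M (zgen eM)) = E (Realification.of M 1) := by rw [h1, map_one, map_one]
  have h2 : zgen eM = 1 := Realification.of_injective (IsMonoprime.ofZ ⟨⟨eM⟩⟩) (E.injective h1')
  have h3 : eM (zgen eM) = 1 := by rw [h2, map_one]
  rw [zgen, MulEquiv.apply_symm_apply] at h3
  exact one_ne_zero (Multiplicative.ofAdd.injective (h3.trans ofAdd_zero.symm))

/-- KEY: if `x^n = m ⊗ 1` then `n · E(x) = deg(m) · c`. [cite: MochizukiFrdI2008, §0 p.10] -/
theorem natCast_mul_toAdd_E {x : Realification M} {n : ℕ} {m : M} (h : Realification.of M m = x ^ n) :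
    (n : ℝ≥0) * Multiplicative.toAdd (E x) = (zdeg eM m : ℝ≥0) * slope eM E := by
  rw [← toAdd_E_of eM E m, h, map_pow, toAdd_pow, nsmul_eq_mul]

/-- A positive exponent `n` with `x^n ∈ M ⊗ 1`, for `x ∈ M^pf` (a choice). [cite: MochizukiFrdI2008, §0 p.10] -/
def perfExp (x : perf M) : ℕ := Classical.choose ((mem_perf_iff x.1).mp x.2)

/-- The exponent is positive. [cite: MochizukiFrdI2008, §0 p.10] -/
theorem perfExp_pos (x : perf M) : 0 < perfExp x := (Classical.choose_spec ((mem_perf_iff x.1).mp x.2)).1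

/-- A witness `m ∈ M` with `m ⊗ 1 = x ^ n` (a choice). [cite: MochizukiFrdI2008, §0 p.10] -/
def perfWit (x : perf M) : M := Classical.choose (Set.mem_range.mp (Classical.choose_spec ((mem_perf_iff x.1).mp x.2)).2)

/-- `perfWit x ⊗ 1 = x ^ perfExp x`. [cite: MochizukiFrdI2008, §0 p.10] -/
theorem of_perfWit (x : perf M) : Realification.of M (perfWit x) = x.1 ^ perfExp x :=
  Classical.choose_spec (Set.mem_range.mp (Classical.choose_spec ((mem_perf_iff x.1).mp x.2)).2)

/-- The rational degree of an element of the perfection: `deg(m)/n` for (the chosen) `x^n = m ⊗ 1`.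
[cite: MochizukiFrdI2008, §0 p.10] -/
def ratDeg (x : perf M) : ℚ≥0 := (zdeg eM (perfWit x) : ℚ≥0) / (perfExp x : ℚ≥0)

/-- `ratDeg(x) · c = E(x)`. [cite: MochizukiFrdI2008, §0 p.10] -/
theorem ratDeg_mul_slope (x : perf M) :
    ((ratDeg eM x : ℚ≥0) : ℝ≥0) * slope eM E = Multiplicative.toAdd (E x.1) := by
  have key := natCast_mul_toAdd_E eM E (of_perfWit x)
  have hn' : ((perfExp x : ℕ) : ℝ≥0) ≠ 0 := Nat.cast_ne_zero.mpr (perfExp_pos x).ne'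
  rw [ratDeg, NNRat.cast_div, NNRat.cast_natCast, NNRat.cast_natCast, div_mul_eq_mul_div, ← key,
    mul_div_cancel_left₀ _ hn']

/-- Uniqueness of the rational degree. [cite: MochizukiFrdI2008, §0 p.10] -/
theorem ratDeg_eq_of {x : perf M} {q : ℚ≥0} (h : ((q : ℚ≥0) : ℝ≥0) * slope eM E = Multiplicative.toAdd (E x.1)) :
    ratDeg eM x = q := by
  have h' := (ratDeg_mul_slope eM E x).trans h.symm
  exact NNRat.cast_injective (mul_right_cancel₀ (slope_ne_zero eM E) h')

/-- The element of the perfection of rational degree `q`: `E⁻¹(q · c)`. [cite: MochizukiFrdI2008, §0 p.10] -/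
def ofRatDeg (q : ℚ≥0) : perf M :=
  ⟨E.symm (Multiplicative.ofAdd (((q : ℚ≥0) : ℝ≥0) * slope eM E)), by
    refine ⟨q.den, q.den_pos, zgen eM ^ q.num, ?_⟩
    have hq : (q.num : ℚ≥0) = q * q.den := (div_eq_iff (Nat.cast_ne_zero.mpr q.den_pos.ne')).mp (NNRat.num_div_den q)
    have hq' : (q.num : ℝ≥0) = ((q : ℚ≥0) : ℝ≥0) * (q.den : ℝ≥0) := by
      rw [← NNRat.cast_natCast q.num, hq, NNRat.cast_mul, NNRat.cast_natCast]
    apply E.injective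
    apply Multiplicative.toAdd.injective
    rw [toAdd_E_of eM E (zgen eM ^ q.num), zdeg_zgen_pow, map_pow E, toAdd_pow, MulEquiv.apply_symm_apply,
      toAdd_ofAdd, nsmul_eq_mul, hq']
    ring⟩

/-- **`M^pf ≅ ℚ_{≥0}`** for `M ≅ ℤ_{≥0}`, via the rational degree (with respect to any realification
coordinate `E : M ⊗ ℝ_{≥0} ≅ ℝ_{≥0}`). [cite: MochizukiFrdI2008, §0 p.10] -/
def perfEquiv : perf M ≃* Multiplicative ℚ≥0 where
  toFun x := Multiplicative.ofAdd (ratDeg eM x)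
  invFun q := ofRatDeg eM E (Multiplicative.toAdd q)
  left_inv x := by
    apply Subtype.ext
    apply E.injective
    change E (E.symm _) = _
    rw [MulEquiv.apply_symm_apply, toAdd_ofAdd, ratDeg_mul_slope eM E x, ofAdd_toAdd]
  right_inv q := by
    change Multiplicative.ofAdd (ratDeg eM (ofRatDeg eM E (Multiplicative.toAdd q))) = q
    rw [ratDeg_eq_of eM E (q := Multiplicative.toAdd q), ofAdd_toAdd]
    change _ = Multiplicative.toAdd (E (E.symm _))
    rw [MulEquiv.apply_symm_apply, toAdd_ofAdd]
  map_mul' x y := by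
    rw [← ofAdd_add, ratDeg_eq_of eM E (q := ratDeg eM x + ratDeg eM y)]
    rw [NNRat.cast_add, add_mul, ratDeg_mul_slope, ratDeg_mul_slope, ← toAdd_mul, ← map_mul]
    rfl

end QMonoprime

/-- **The perfection of a `ℤ`-monoprime monoid is `ℚ`-monoprime.** [cite: MochizukiFrdI2008, §0 p.10] -/
theorem isQMonoprime_perf (hM : IsZMonoprime M) : IsQMonoprime (perf M) := by
  obtain ⟨⟨eM⟩⟩ := hM
  obtain ⟨⟨E⟩⟩ := isRMonoprime_realification (IsMonoprime.ofZ ⟨⟨eM⟩⟩)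
  exact ⟨⟨perfEquiv eM E⟩⟩

end Realification

/-! ### The `p`-adic Frobenioid of the perfection -/

namespace PadicFrd

open CategoryTheory Opposite ValuativeRel

universe v

variable {D : Type u} [Category.{v} D] {p : ℕ} [Fact p.Prime] (base : D ⥤ PadicFld.{u} p)

/-- `A ↦ ord(O_{K_A}^⊳)^pf ⊆ Φ₀(A)` as a `SubDatum` over a base of `p`-adic local fields: stable under the
pull-back maps, `ℚ`-monoprime (`ord(O_K^⊳) ≅ ℤ_{≥0}`, abc-iut-L1-d10), nonzero on the lift of `p`.
[cite: MochizukiFrdII2008, Ex 1.1 (ii) p.8] -/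
def perfSubDatum (hloc : ∀ A : D, (base.obj A).IsPadicLocal) : SubDatum base where
  S A := Realification.perf (OrdInt (base.obj A).K)
  map_mem f x hx := Realification.map_mem_perf _ hx
  isMonoprime A := by
    obtain ⟨⟨inst, hfin, hc⟩⟩ := hloc A
    letI := inst
    haveI := hfin
    exact IsMonoprime.ofQ (Realification.isQMonoprime_perf (isZMonoprime_ordInt hc))
  g A := ⟨((p : ℕ) : (base.obj A).K), (base.obj A).p_mem⟩
  g_mem A := Realification.of_mem_perf _
  g_not_isUnit A h := (base.obj A).p_lt.ne ((isUnit_intNonzero_iff _ _).mp h)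

/-- **The `p`-adic Frobenioid datum of the perfection** `Φ := ord(O^⊳)^pf ⊆ Φ₀|_D` (FrdII Ex. 1.1 (ii) with
`Λ = ℤ` and `ℚ`-monoprime `Φ`; the datum of `C_v` in [IUTchI] Ex. 3.3 (i)). [cite: MochizukiFrdII2008, Ex 1.1 (ii) p.8] -/
def Datum.perf (hloc : ∀ A : D, (base.obj A).IsPadicLocal) (hc : IsConnected D) (he : IsTotallyEpimorphic D) :
    Datum D p :=
  (perfSubDatum base hloc).toDatum hloc hc he

omit [Fact p.Prime] in
/-- "`Φ_{C_v^⊢} ⊆ Φ_{C_v}`": the absolutely primitive `Φ^⊢(A) = ℤ_{≥0} · ord(p)` (`Datum.prim`) lies in the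
perfection `ord(O_{K_A}^⊳)^pf`. [cite: MochizukiFrdII2008, Ex 1.1 (ii) p.8] -/
theorem Datum.prim_Φ_le_perf (A : D) :
    Submonoid.powers (primGen base A) ≤ Realification.perf (OrdInt (base.obj A).K) :=
  (Submonoid.powers_le).mpr (Realification.of_mem_perf _)

end PadicFrd

end Literature.AlgebraicGeometry.Frobenioids
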